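import Summits.CriticalPhenomena.PercolationContinuityZ3.Theorems.PercNearOneGluingNoHeavyLowerTailKnQuestion8CoefficientwiseTrivialCoreFlip
import HarnessLib

/-!
# Core class `N(x) = N(z) = {a, b}`: cluster bookkeeping for the two terminals

Support file (`--supports stmt-CriticalPhenomena-4575`, closed), prover `prim-cplus-coupling` (gen 29).  No definitions, no notations, no named facts,
no sorries; standard axioms.  Companions: `…CoefficientwiseCoreClassPeeling.lean` (the peeling identities), `…CoefficientwiseCoreClassKernel.lean`
(the kernel inequality), `…CoefficientwiseCoreClass.lean` (the theorem).

Setting (prim-lf-2's CORE CLASS at `|N| = 2`, memo `prim-cplus-coupling/A5-COUPLING-gen29.md` §3.4): a finite multigraph `ends : ι → Sym2 V` whose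
edge set is `E₀ = E_H ∪ {ixa, ixb, iza, izb}` with `ends ixa = s(x,a)`, `ends ixb = s(x,b)`, `ends iza = s(z,a)`, `ends izb = s(z,b)` and no edge of `E_H`
at `x` or `z`: the terminals `x, z` have the common neighbourhood `{a, b}` through single edges, the middle graph `H = (V, E_H)` is arbitrary.
Colourings `s ⊆ E₀` (red) / `E₀ ∖ s` (blue), `K = C_x(s)`, `L = C_x(E₀ ∖ s)`, wall `T = {z ∉ K} ∩ {z ∉ L}`; `C_v(ω) = openCluster (ends '' ω) v`.
* `not_mem_openCluster_of_no_edge_at`, `openCluster_eq_singleton_of_no_edge_at` — a vertex met by no edge of `s` is outside every other cluster / has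
  cluster `{x}`;
* `coreClass_reach_z` — `xa, za` red ⇒ `z ∈ K`;
* `coreClass_cluster_two` — `xa, xb` red, `za, zb` not red ⇒ `K = {x} ∪ C_a(s ∩ E_H) ∪ C_b(s ∩ E_H)`;
* `coreClass_cluster_one` — `xa` red, `xb, za` not red and `b ∉ C_a(s ∩ E_H)` ⇒ `K = {x} ∪ C_a(s ∩ E_H)`.
All by the closed-set principle `openCluster_subset_of_closed` (…CoefficientwiseTrivialCoreFlip).
[cite: KozmaNitzan2024, Questions 8–9 (§5.5 p. 36) (context: the Question-8 pocket covariance programme)]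
-/

namespace Summit.CriticalPhenomena.PercolationContinuityZ3.Theorems

open Finset Literature.Probability.Percolation

namespace Coefficientwise

variable {ι V : Type*}

/-- If no edge of `s` meets `z`... more precisely: if every edge of `s` with `z` among its ends is absent, then `z ∉ C_x(s)` for `x ≠ z`.
[cite: KozmaNitzan2024, §5.5 (context only; folklore)] -/
theorem not_mem_openCluster_of_no_edge_at (ends : ι → Sym2 V) (s : Finset ι) {x z : V} (hxz : x ≠ z)
    (hs : ∀ i ∈ s, z ∉ ends i) : z ∉ openCluster (ends '' (↑s : Set ι)) x := by
  intro hz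
  have key : openCluster (ends '' (↑s : Set ι)) x ⊆ {y | y ≠ z} := by
    refine openCluster_subset_of_closed ends s x (S := {y | y ≠ z}) hxz ?_
    intro i hi p q he _ hqz
    exact hs i hi (by rw [he, hqz]; exact Sym2.mem_mk_right p z)
  exact key hz rfl

/-- `x` meets no edge of `s` ⇒ `C_x(s) = {x}`. [cite: KozmaNitzan2024, §5.5 (context only; folklore)] -/
theorem openCluster_eq_singleton_of_no_edge_at (ends : ι → Sym2 V) (s : Finset ι) {x : V}
    (hs : ∀ i ∈ s, x ∉ ends i) : openCluster (ends '' (↑s : Set ι)) x = {x} := by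
  apply Set.Subset.antisymm
  · refine openCluster_subset_of_closed ends s x (S := ({x} : Set V)) rfl ?_
    intro i hi p q he hp
    rw [Set.mem_singleton_iff] at hp
    subst hp
    exact absurd (by rw [he]; exact Sym2.mem_mk_left p q) (hs i hi)
  · intro y hy
    rw [Set.mem_singleton_iff] at hy
    subst hy
    exact mem_openCluster_self _ _

/-- A red path `x – a – z`: if the edges `xa` and `za` are both in `s` then `z ∈ C_x(s)`. [cite: KozmaNitzan2024, §5.5 (context only)] -/
theorem coreClass_reach_z (ends : ι → Sym2 V) (s : Finset ι) {x z a : V} {ixa iza : ι} (hxa : ends ixa = s(x, a)) (hza : ends iza = s(z, a))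
    (h1 : ixa ∈ s) (h2 : iza ∈ s) : z ∈ openCluster (ends '' (↑s : Set ι)) x :=
  mem_openCluster_of_edge ends h2 (hza.trans Sym2.eq_swap) (mem_openCluster_of_edge ends h1 hxa (mem_openCluster_self _ _))

/-- **Cluster bookkeeping, both `x`-edges red.**  If `xa, xb ∈ s`, `za, zb ∉ s`, the other edges of `s` lie in `E_H` (no edge of `E_H` at `x`), then
`C_x(s) = {x} ∪ C_a(s ∩ E_H) ∪ C_b(s ∩ E_H)`. [cite: KozmaNitzan2024, §5.5 (context only)] -/
theorem coreClass_cluster_two [DecidableEq ι] (ends : ι → Sym2 V) (EH s : Finset ι) {x a b : V} {ixa ixb iza izb : ι}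
    (hxa : ends ixa = s(x, a)) (hxb : ends ixb = s(x, b))
    (hHx : ∀ i ∈ EH, x ∉ ends i) (hsub : ∀ i ∈ s, i ∈ EH ∨ i = ixa ∨ i = ixb ∨ i = iza ∨ i = izb)
    (h1 : ixa ∈ s) (h2 : ixb ∈ s) (h3 : iza ∉ s) (h4 : izb ∉ s) :
    openCluster (ends '' (↑s : Set ι)) x =
      {x} ∪ openCluster (ends '' (↑(s ∩ EH) : Set ι)) a ∪ openCluster (ends '' (↑(s ∩ EH) : Set ι)) b := by
  apply Set.Subset.antisymm
  · refine openCluster_subset_of_closed ends s x (S := {x} ∪ openCluster (ends '' (↑(s ∩ EH) : Set ι)) a ∪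
        openCluster (ends '' (↑(s ∩ EH) : Set ι)) b) (Or.inl (Or.inl rfl)) ?_
    intro i hi p q he hp
    rcases hsub i hi with hiH | rfl | rfl | rfl | rfl
    · have hiω : i ∈ s ∩ EH := Finset.mem_inter.mpr ⟨hi, hiH⟩
      rcases hp with (hp | hp) | hp
      · rw [Set.mem_singleton_iff] at hp; subst hp
        exact absurd (by rw [he]; exact Sym2.mem_mk_left p q) (hHx i hiH)
      · exact Or.inl (Or.inr (mem_openCluster_of_edge ends hiω he hp))
      · exact Or.inr (mem_openCluster_of_edge ends hiω he hp)
    · -- `i = ixa`: `q ∈ {x, a}`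
      have hq : q ∈ s(x, a) := by rw [← hxa, he]; exact Sym2.mem_mk_right p q
      rcases Sym2.mem_iff.mp hq with rfl | rfl
      · exact Or.inl (Or.inl rfl)
      · exact Or.inl (Or.inr (mem_openCluster_self _ _))
    · have hq : q ∈ s(x, b) := by rw [← hxb, he]; exact Sym2.mem_mk_right p q
      rcases Sym2.mem_iff.mp hq with rfl | rfl
      · exact Or.inl (Or.inl rfl)
      · exact Or.inr (mem_openCluster_self _ _)
    · exact absurd hi h3
    · exact absurd hi h4
  · have ha : a ∈ openCluster (ends '' (↑s : Set ι)) x := mem_openCluster_of_edge ends h1 hxa (mem_openCluster_self _ _)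
    have hb : b ∈ openCluster (ends '' (↑s : Set ι)) x := mem_openCluster_of_edge ends h2 hxb (mem_openCluster_self _ _)
    have hmo : ∀ v, openCluster (ends '' (↑(s ∩ EH) : Set ι)) v ⊆ openCluster (ends '' (↑s : Set ι)) v :=
      fun v => openCluster_image_mono ends Finset.inter_subset_left v
    rintro y ((hy | hy) | hy)
    · rw [Set.mem_singleton_iff] at hy; subst hy; exact mem_openCluster_self _ _
    · exact SimpleGraph.Reachable.trans ha (hmo a hy)
    · exact SimpleGraph.Reachable.trans hb (hmo b hy)

/-- **Cluster bookkeeping, one `x`-edge red.**  If `xa ∈ s`, `xb ∉ s`, `za ∉ s`, the other edges of `s` lie in `E_H ∪ {zb}` (no edge of `E_H` at `x` or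
`z`, `z ≠ x`, `b ≠ x`) and `b ∉ C_a(s ∩ E_H)`, then `C_x(s) = {x} ∪ C_a(s ∩ E_H)`. [cite: KozmaNitzan2024, §5.5 (context only)] -/
theorem coreClass_cluster_one [DecidableEq ι] (ends : ι → Sym2 V) (EH s : Finset ι) {x z a b : V} {ixa ixb iza izb : ι}
    (hxa : ends ixa = s(x, a)) (hzb : ends izb = s(z, b)) (hzx : z ≠ x) (hbx : b ≠ x) (hza' : z ≠ a)
    (hH : ∀ i ∈ EH, x ∉ ends i ∧ z ∉ ends i) (hsub : ∀ i ∈ s, i ∈ EH ∨ i = ixa ∨ i = ixb ∨ i = iza ∨ i = izb)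
    (h1 : ixa ∈ s) (h2 : ixb ∉ s) (h3 : iza ∉ s) (hb : b ∉ openCluster (ends '' (↑(s ∩ EH) : Set ι)) a) :
    openCluster (ends '' (↑s : Set ι)) x = {x} ∪ openCluster (ends '' (↑(s ∩ EH) : Set ι)) a := by
  have hzCa : z ∉ openCluster (ends '' (↑(s ∩ EH) : Set ι)) a :=
    not_mem_openCluster_of_no_edge_at ends (s ∩ EH) (Ne.symm hza') (fun i hi => (hH i (Finset.mem_inter.mp hi).2).2)
  apply Set.Subset.antisymm
  · refine openCluster_subset_of_closed ends s x (S := {x} ∪ openCluster (ends '' (↑(s ∩ EH) : Set ι)) a) (Or.inl rfl) ?_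
    intro i hi p q he hp
    rcases hsub i hi with hiH | rfl | rfl | rfl | rfl
    · have hiω : i ∈ s ∩ EH := Finset.mem_inter.mpr ⟨hi, hiH⟩
      rcases hp with hp | hp
      · rw [Set.mem_singleton_iff] at hp; subst hp
        exact absurd (by rw [he]; exact Sym2.mem_mk_left p q) (hH i hiH).1
      · exact Or.inr (mem_openCluster_of_edge ends hiω he hp)
    · have hq : q ∈ s(x, a) := by rw [← hxa, he]; exact Sym2.mem_mk_right p q
      rcases Sym2.mem_iff.mp hq with rfl | rfl
      · exact Or.inl rfl
      · exact Or.inr (mem_openCluster_self _ _)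
    · exact absurd hi h2
    · exact absurd hi h3
    · -- `i = izb`: `p ∈ {z, b}` but neither lies in `S`
      exfalso
      have hp' : p ∈ s(z, b) := by rw [← hzb, he]; exact Sym2.mem_mk_left p q
      rcases Sym2.mem_iff.mp hp' with rfl | rfl
      · rcases hp with hp | hp
        · exact hzx (Set.mem_singleton_iff.mp hp)
        · exact hzCa hp
      · rcases hp with hp | hp
        · exact hbx (Set.mem_singleton_iff.mp hp)
        · exact hb hp
  · have ha : a ∈ openCluster (ends '' (↑s : Set ι)) x := mem_openCluster_of_edge ends h1 hxa (mem_openCluster_self _ _)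
    rintro y (hy | hy)
    · rw [Set.mem_singleton_iff] at hy; subst hy; exact mem_openCluster_self _ _
    · exact SimpleGraph.Reachable.trans ha (openCluster_image_mono ends Finset.inter_subset_left a hy)


end Coefficientwise

end Summit.CriticalPhenomena.PercolationContinuityZ3.Theorems
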